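import Literature.MathematicalPhysics.QuantumFieldTheory.Balaban1983to89.B4RegionCubeCarrier

/-!
# `Balaban1983to89.B4CubeGreenRegion` — [Balaban1983RegularityDecay] §2 pp. 575–576: ON A GENERAL REGION `Ω`, THE CUBE
# PROPAGATORS `G_k(□_j, Ã_j)` OF THE PARAMETRIX (2.2) — the Neumann-cut cube data of the general-`Ω` chain
# `B4Ineq110LpChain.ineq110_value_lp` on `fineDom n Ωc` (links/transporters of `Ã_j` on the cube, null off it), the
# hypothesis `hGj` DISCHARGED for every cube (boundary cubes: the Green's function of the SUB-REGION `Ω ∩ □̂_j` at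
# `Ã_j = A`; interior cubes: the Lemma-2.2 lineage's `greenA` on the translated `2K`-box), and the letters `h_jG_jh_j`,
# `K_jG_jh_j` as padded sub-carrier letters (with p17's generic `B4CubeOpReindex`)

statement-level skeleton of published theorems with citation tags; proofs where landed; nothing here is a claim about the Yang–Mills mass gap

CITATION HEADER.  T. Bałaban, *Regularity and decay of lattice Green's functions*, Commun. Math. Phys. **89** (1983)
571–597, doi:10.1007/bf01214744 [Balaban1983RegularityDecay] (cell paper B4; held text
`paper:balaban1983-cmp89-regularity-decay`, journal page = PDF page + 570; pp. 572, 575–578).  Unit `lit-balaban-r01`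
gen 7 (B4 fold owner), HOME `run/shared/lean/pub/lit-balaban/`, SKELETON rows **B4.Eq2.2** (`G₀ = Σ_j h_jG_k(□_j,Ã_j)h_j`),
**B4.Eq2.10** (`R = Σ_j K_jG_k(□_j,Ã_j)h_j`), **B4.Def§2**, **B4.Thm@573** (file 3 of the r01 g7 programme: THEOREM (1.10)
value member for a GENERAL `Ω` under `R₀`, end to end).  Imports r01 g7's `B4RegionCubeCarrier` (file 2: `cubeLabels`,
`cshift`, `inBox`, `incl`/`inclY`, `boxEmb`/`boxEmbY`, data identities; → p17 g4's `B4CubeGreenBox`/`B4SubBoxCarrier`/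
`B4CubeOpReindex`: `pad`, `cinv`, `cutWt`, `cdeg`, `covOp_cut_mul_padInv`, `norm_padInv_le`, `letter_a_eq_pad`,
`letter_b_eq_pad`; → r01 g6's `B4WalkRouteRegion`: `rpos`, `covOp_blockLocal_posDef`; → `B4Lemma22Invertible`:
`opA_stair_isUnit_det`).

WHAT IS PRINTED (verbatim).  p. 575: «Let us define an operator G₀ by the formula G₀ = Σ_j h_jG_k(□_j, A_j)h_j, (2.2) where
the configurations A_j are constructed in the following way : if □_j intersects the boundary of Ω, then A_j = A; if □_j is
an interior cube of Ω, then … Ã_j = A₀ + θ_jA′»; p. 576: «(−Δ^{η,N}_{A,Ω})h_jG(□_j, A_j) = (−Δ^{η,N}_{A_j,□_j})h_jG(□_j, A_j),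
(2.6) because the function h_j can be ≠ 0 only on the part of the boundary of □_j which is contained in the boundary of
Ω»; (2.10)–(2.11) `R = Σ_j K_jG_k(□_j,Ã_j)h_j`; p. 579: «we do not have the inequalities (2.16) for the norms other than
L₂-norms if □_j is not a cube».

WHAT THIS MODULE PROVES (all in full; region `Ω = fineDom n Ωc`, `n = L^k`, `L = ℓ + 1`; cube size `K` unit blocks, so
`M = nK`; cube `□_j`: site set `cubeS = inBox n (cshift K j) 2K`, sub-region labels `subLabels = Ωc ∩ cubeLabels K j`).
* §1 THE CUBE DATA: `cubeW`/`cubeT` — links `U(κÃ_b)` between sites of the cube and transporters `U(Ã(Γ_{y,x}))` along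
  the region's staircase contours for sites of the cube, NULL off the cube (free data of the walk route outside the
  plateau); `cubeS_of_hCube_ne_zero` (`supp h_j ⊆ □_j`); `cdeg_ge` (off the cube every site keeps a neighbour of its own
  unit block off the cube: outgoing cut weight `≥ n²/2`, `n ≥ 2`).
* §2 EVERY CUBE AS A SUB-REGION («Ã_j = A» at the boundary; Lemma 2.1 lives here): `subData_eq_incl` (the restricted cut
  data ARE the operator (1.6) of the sub-region `fineDom n (Ωc ∩ cubeLabels K j)` with the restricted field),
  `cubeGreenI = pad_incl(G_k(Ω ∩ □̂_j, Ã_j|)) + cinv`, **`cubeOp_mul_cubeGreenI`** (`hGj`, every field, `a′ > 0`,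
  `m² ≥ 0`, `n ≥ 2`; invertibility from `covOp_blockLocal_posDef`), `cube_letter_b_I` (the letter `K_jG_jh_j` is the
  padded sub-region letter — the input of `B4Eq221HjRegion.eq221_l2_region_hZ`).
* §3 INTERIOR CUBES AS TRANSLATED BOXES (where Lemma 2.2 lives): `subData_eq_box` (the restricted cut data ARE
  `B4Lemma22ReduceZero.opA` on `Box d ℓ k 2K` at the restricted field), `cubeGreenB = pad_boxEmb(greenA) + cinv`,
  **`cubeOp_mul_cubeGreenB`** (`hGj`; invertibility from `opA_stair_isUnit_det`), **`norm_cubeGreenB_le`** (the input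
  `γ`: `‖G_j‖ ≤ max ‖greenA‖ (2/n²)`), `cube_letter_b_B` (the letter `K_jG_jh_j` is the padded box letter with
  `B4Eq220CommutatorField.kOp`-shaped data — the input of p35's `B4Eq220CubeField`).
* §4 THE PLATEAU «Ã_j = A on {x : |x − Mj| ≤ ¾M}»: `cubeW_window` (`hWW'` of the chain: on two core sites where
  `Ã_j = A` the cube link is the region's link), `rstairContour_core` (for `4 ∣ K` the staircase `Γ_{y,x}` of a core
  site runs in the core — coordinatewise monotone from the base corner, lower faces on the unit grid),
  **`cubeT_window`** (`hTT'` of the chain: the cube transporter is the region's transporter as soon as `Ã_j = A` on the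
  nearest-neighbour bonds of the core).
* §5 `isBlockUnion_subLabels`: `Ω ∩ □̂_j` is a union of `K`-blocks when `Ω` is (hypothesis of the boundary-cube factor).
HONEST SCOPE.  Structural only (no analytic bound); the cube configurations `Ã_j` are parameters `At` here (the
assembly takes p35's `cubeField` at interior cubes and `A` at boundary cubes); `def`s with bodies (`cubeW`, `cubeT`,
`cubeGreenI`, `cubeGreenB`) and reducible abbreviations, no `Prop` fact, no `sorry`; axioms standard.
-/

namespace Literature.MathematicalPhysics.QuantumFieldTheory.Balaban1983to89.B4CubeGreenRegion

open Literature.MathematicalPhysics.QuantumFieldTheory.Balaban1983to89.B4Reflection242 (boxDom mem_boxDom nbrs mem_nbrs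
  blk blk_mem_boxDom)
open Literature.MathematicalPhysics.QuantumFieldTheory.Balaban1983to89.B4GaugeCovariance
open Literature.MathematicalPhysics.QuantumFieldTheory.Balaban1983to89.B4Commutators25to211 (mulH opK)
open Literature.MathematicalPhysics.QuantumFieldTheory.Balaban1983to89.B4Lower18 (fineDom mem_fineDom IsBlockUnion)
open Literature.MathematicalPhysics.QuantumFieldTheory.Balaban1983to89.B4Lower18Regular (e1 baseEmb stairContour
  PathRel stair mem_stair base_le_of_blk pathRel_stair pathRel_pmap_iff)
open Literature.MathematicalPhysics.QuantumFieldTheory.Balaban1983to89.B4Lower18RegularRegion (regWt rBlkWt rbaseEmb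
  rstairContour regWt_nonneg rBlkWt_ne_zero)
open Literature.MathematicalPhysics.QuantumFieldTheory.Balaban1983to89.B4Lemma22ReduceZero (Box opA greenA)
open Literature.MathematicalPhysics.QuantumFieldTheory.Balaban1983to89.B4Lemma22Invertible (opA_stair_isUnit_det)
open Literature.MathematicalPhysics.QuantumFieldTheory.Balaban1983to89.B4PartitionUnity22 (hCube hCube_ne_zero_imp)
open Literature.MathematicalPhysics.QuantumFieldTheory.Balaban1983to89.B4CubeOpReindex
open Literature.MathematicalPhysics.QuantumFieldTheory.Balaban1983to89.B4WalkRouteRegion (rpos covOp_blockLocal_posDef)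
open Literature.MathematicalPhysics.QuantumFieldTheory.Balaban1983to89.B4RegionCubeCarrier
open scoped Matrix
open scoped Matrix.Norms.Operator

noncomputable section

variable {d : ℕ}

section Cube

variable {ι : Type} [Fintype ι] [DecidableEq ι] (F : OrthFlow ι) (κ : ℝ)
variable (ℓ k : ℕ) (Ωc : Finset (Fin (d + 1) → ℤ)) (K : ℕ)

/-- the mesh `n = L^k ≥ 1`. [folklore] -/
private theorem one_le_n : 1 ≤ (ℓ + 1) ^ k := Nat.one_le_pow _ _ (Nat.succ_pos ℓ)

/-! ## §1. The cube data of the general-`Ω` chain -/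

/-- **THE SITE SET `S_j` OF THE CUBE `□_j`**: the unit blocks of `Ω` with label in the `2K`-cube at `Kj`.
[cite: Balaban1983RegularityDecay, §2 p.575 «□_j = Ω ∩ {…}»] -/
abbrev cubeS (j : Fin (d + 1) → ℤ) : ↥(fineDom ((ℓ + 1) ^ k) Ωc) → Prop :=
  inBox ((ℓ + 1) ^ k) (cshift K j) (fun _ => 2 * K)

/-- **THE CUBE LINKS**: `U(κÃ_b)` between sites of `□_j`, NULL off the cube. [cite: Balaban1983RegularityDecay, (2.6) p.576, (1.2) p.572] -/
def cubeW (At : ↥(fineDom ((ℓ + 1) ^ k) Ωc) → ↥(fineDom ((ℓ + 1) ^ k) Ωc) → ℝ) (j : Fin (d + 1) → ℤ) :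
    ↥(fineDom ((ℓ + 1) ^ k) Ωc) → ↥(fineDom ((ℓ + 1) ^ k) Ωc) → Matrix ι ι ℝ :=
  fun x z => if cubeS ℓ k Ωc K j x ∧ cubeS ℓ k Ωc K j z then fieldLink F κ At x z else 0

/-- **THE CUBE TRANSPORTERS**: `U(Ã(Γ_{y,x}))` along the region's staircase contours for sites of `□_j`, NULL off the
cube. [cite: Balaban1983RegularityDecay, (2.6) p.576, (1.4) p.572] -/
def cubeT (At : ↥(fineDom ((ℓ + 1) ^ k) Ωc) → ↥(fineDom ((ℓ + 1) ^ k) Ωc) → ℝ) (j : Fin (d + 1) → ℤ) :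
    ↥Ωc → ↥(fineDom ((ℓ + 1) ^ k) Ωc) → Matrix ι ι ℝ :=
  fun y x => if cubeS ℓ k Ωc K j x then
    contourTrans (fieldLink F κ At) (rbaseEmb (one_le_n ℓ k) Ωc) (rstairContour (one_le_n ℓ k) Ωc) y x else 0

omit [Fintype ι] [DecidableEq ι] in
/-- **`supp h_j ⊆ □_j`**: a site where the walk route's `h_j` (`M = nK`) does not vanish lies in the cube's site set.
[cite: Balaban1983RegularityDecay, §2 p.575 «h_j … supported in □_j»] -/
theorem cubeS_of_hCube_ne_zero {K : ℕ} (hK : 1 ≤ K) (j : Fin (d + 1) → ℤ) (z : ↥(fineDom ((ℓ + 1) ^ k) Ωc))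
    (h : hCube ((((ℓ + 1) ^ k : ℕ) : ℝ) * K) j (rpos ((ℓ + 1) ^ k) Ωc z) ≠ 0) : cubeS ℓ k Ωc K j z := by
  have hn := one_le_n ℓ k
  have hM : (0 : ℝ) < (((ℓ + 1) ^ k : ℕ) : ℝ) * K := by
    have h1 : (1 : ℝ) ≤ (((ℓ + 1) ^ k : ℕ) : ℝ) := by exact_mod_cast hn
    have h2 : (1 : ℝ) ≤ K := by exact_mod_cast hK
    nlinarith
  refine inBox_of_near hn hK j z fun μ => ?_
  have := hCube_ne_zero_imp hM h μ
  linarith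

omit [Fintype ι] [DecidableEq ι] in
/-- the cut bond weights of the region are non-negative. [cite: Balaban1983RegularityDecay, (1.3) p.572] -/
theorem cutWt_regWt_nonneg (S : ↥(fineDom ((ℓ + 1) ^ k) Ωc) → Prop) [DecidablePred S]
    (z y : ↥(fineDom ((ℓ + 1) ^ k) Ωc)) : 0 ≤ cutWt S (regWt ((ℓ + 1) ^ k) (fineDom ((ℓ + 1) ^ k) Ωc)) z y := by
  simp only [cutWt]
  split_ifs
  · exact regWt_nonneg _ _ z y
  · exact le_rfl

omit [Fintype ι] [DecidableEq ι] in
/-- a lattice point has, in every direction, a nearest neighbour IN ITS OWN `n`-BLOCK when `n ≥ 2`. [folklore] -/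
private theorem exists_nbr_same_blk {n : ℕ} (hn : 2 ≤ n) (z : Fin (d + 1) → ℤ) (i : Fin (d + 1)) :
    ∃ z', z' ∈ nbrs z ∧ blk n z' = blk n z := by
  have hn0 : (0 : ℤ) < n := by exact_mod_cast (by omega : 0 < n)
  have hr0 := Int.emod_nonneg (z i) hn0.ne'
  have hr1 := Int.emod_lt_of_pos (z i) hn0
  have hdiv := Int.mul_ediv_add_emod (z i) (n : ℤ)
  by_cases hup : z i % n + 1 < n
  · refine ⟨z + e1 i, mem_nbrs.2 ⟨i, Or.inl rfl⟩, funext fun l => ?_⟩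
    by_cases hl : l = i
    · subst hl
      simp only [blk, Pi.add_apply, B4Lower18Regular.e1_apply_self]
      exact ((Int.ediv_emod_unique (a := z l + 1) (b := (n : ℤ)) (r := z l % n + 1) (q := z l / n) hn0).2
        ⟨by linarith, by linarith, hup⟩).1
    · simp only [blk, Pi.add_apply, B4Lower18Regular.e1_apply_ne hl, add_zero]
  · refine ⟨z - e1 i, mem_nbrs.2 ⟨i, Or.inr rfl⟩, funext fun l => ?_⟩
    by_cases hl : l = i
    · subst hl
      simp only [blk, Pi.sub_apply, B4Lower18Regular.e1_apply_self]
      have hn2 : (2 : ℤ) ≤ n := by exact_mod_cast hn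
      exact ((Int.ediv_emod_unique (a := z l - 1) (b := (n : ℤ)) (r := z l % n - 1) (q := z l / n) hn0).2
        ⟨by linarith, by linarith, by linarith⟩).1
    · simp only [blk, Pi.sub_apply, B4Lower18Regular.e1_apply_ne hl, sub_zero]

omit [Fintype ι] [DecidableEq ι] in
/-- **COMPLEMENT DEGREES**: off the cube every site keeps a nearest neighbour of its own unit block off the cube (`n ≥ 2`),
so its outgoing cut weight is `≥ n²/2` — the diagonal operator off the cube is safely invertible.
[cite: Balaban1983RegularityDecay, (1.3) p.572, dictionary] -/
theorem cdeg_ge (hn2 : 2 ≤ (ℓ + 1) ^ k) (o : Fin (d + 1) → ℤ) (Ms : Fin (d + 1) → ℕ)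
    {z : ↥(fineDom ((ℓ + 1) ^ k) Ωc)} (hz : ¬ inBox ((ℓ + 1) ^ k) o Ms z) :
    ((((ℓ + 1) ^ k : ℕ) : ℝ)) ^ 2 / 2
      ≤ cdeg (inBox ((ℓ + 1) ^ k) o Ms) (regWt ((ℓ + 1) ^ k) (fineDom ((ℓ + 1) ^ k) Ωc)) z := by
  classical
  have hn := one_le_n ℓ k
  obtain ⟨w, hw, hblk⟩ := exists_nbr_same_blk hn2 z.1 0
  have hwmem : w ∈ fineDom ((ℓ + 1) ^ k) Ωc := by
    rw [mem_fineDom hn, hblk]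
    exact (mem_fineDom hn).1 z.2
  set z' : ↥(fineDom ((ℓ + 1) ^ k) Ωc) := ⟨w, hwmem⟩ with hz'
  have hz'out : ¬ inBox ((ℓ + 1) ^ k) o Ms z' := fun h =>
    hz ((inBox_iff_of_blk_eq o Ms (z := z) (z' := z') hblk.symm).mpr h)
  have hterm : cutWt (inBox ((ℓ + 1) ^ k) o Ms) (regWt ((ℓ + 1) ^ k) (fineDom ((ℓ + 1) ^ k) Ωc)) z z'
      = ((((ℓ + 1) ^ k : ℕ) : ℝ)) ^ 2 / 2 := by
    simp only [cutWt, if_pos (iff_of_false hz hz'out)]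
    unfold regWt
    rw [if_pos hw, mul_one]
  rw [← hterm]
  exact Finset.single_le_sum (f := fun y => cutWt (inBox ((ℓ + 1) ^ k) o Ms)
    (regWt ((ℓ + 1) ^ k) (fineDom ((ℓ + 1) ^ k) Ωc)) z y) (fun y _ => cutWt_regWt_nonneg ℓ k Ωc _ z y)
    (Finset.mem_univ z')

/-! ## §2. Every cube as a sub-region: `□_j = Ω ∩ □̂_j`, the Green's function of the sub-region -/

/-- the unit labels of the sub-region `Ω ∩ □̂_j`. [cite: Balaban1983RegularityDecay, §2 p.575 «□_j = Ω ∩ {…}»] -/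
abbrev subLabels (j : Fin (d + 1) → ℤ) : Finset (Fin (d + 1) → ℤ) := Ωc ∩ cubeLabels K j

omit [Fintype ι] [DecidableEq ι] in
/-- the sub-region's labels are labels of `Ω`. [cite: Balaban1983RegularityDecay, §2 p.575] -/
theorem subLabels_subset (j : Fin (d + 1) → ℤ) : subLabels Ωc K j ⊆ Ωc := Finset.inter_subset_left

/-- the cube configuration seen on the sub-region's own carrier. [cite: Balaban1983RegularityDecay, §2 p.575 «A_j = A», dictionary] -/
abbrev subFieldI (At : ↥(fineDom ((ℓ + 1) ^ k) Ωc) → ↥(fineDom ((ℓ + 1) ^ k) Ωc) → ℝ) (j : Fin (d + 1) → ℤ) :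
    ↥(fineDom ((ℓ + 1) ^ k) (subLabels Ωc K j)) → ↥(fineDom ((ℓ + 1) ^ k) (subLabels Ωc K j)) → ℝ :=
  fun a b => At (incl (one_le_n ℓ k) (subLabels_subset Ωc K j) a) (incl (one_le_n ℓ k) (subLabels_subset Ωc K j) b)

omit [Fintype ι] [DecidableEq ι] in
/-- the image of the sub-region inclusion is the cube's site set. [cite: Balaban1983RegularityDecay, §2 p.575] -/
theorem cubeS_iff_incl (j : Fin (d + 1) → ℤ) (x : ↥(fineDom ((ℓ + 1) ^ k) Ωc)) :
    cubeS ℓ k Ωc K j x ↔ ∃ a, incl (one_le_n ℓ k) (subLabels_subset Ωc K j) a = x := by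
  rw [← inReg_iff (one_le_n ℓ k) (subLabels_subset Ωc K j), inReg_inter_cube_iff (one_le_n ℓ k)]

omit [Fintype ι] [DecidableEq ι] in
/-- an embedded sub-region site lies in the cube's site set. [cite: Balaban1983RegularityDecay, §2 p.575] -/
theorem cubeS_incl (j : Fin (d + 1) → ℤ) (a : ↥(fineDom ((ℓ + 1) ^ k) (subLabels Ωc K j))) :
    cubeS ℓ k Ωc K j (incl (one_le_n ℓ k) (subLabels_subset Ωc K j) a) :=
  (cubeS_iff_incl ℓ k Ωc K j _).mpr ⟨a, rfl⟩

/-- **THE RESTRICTED CUT DATA ARE [B4]'s OPERATOR (1.6) OF THE SUB-REGION `Ω ∩ □̂_j`** with the restricted field (print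
(2.6)), for every coefficient `a′` and mass `m²`. [cite: Balaban1983RegularityDecay, (2.6) p.576, (1.6) p.572] -/
theorem subData_eq_incl (m2 a' : ℝ) (At : ↥(fineDom ((ℓ + 1) ^ k) Ωc) → ↥(fineDom ((ℓ + 1) ^ k) Ωc) → ℝ)
    (j : Fin (d + 1) → ℤ) :
    covOp (fun b b' => regWt ((ℓ + 1) ^ k) (fineDom ((ℓ + 1) ^ k) Ωc)
        (incl (one_le_n ℓ k) (subLabels_subset Ωc K j) b) (incl (one_le_n ℓ k) (subLabels_subset Ωc K j) b')) m2 a'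
      (fun y' b => rBlkWt ((ℓ + 1) ^ k) Ωc (fineDom ((ℓ + 1) ^ k) Ωc) (inclY (subLabels_subset Ωc K j) y')
        (incl (one_le_n ℓ k) (subLabels_subset Ωc K j) b))
      (fun b b' => cubeW F κ ℓ k Ωc K At j (incl (one_le_n ℓ k) (subLabels_subset Ωc K j) b)
        (incl (one_le_n ℓ k) (subLabels_subset Ωc K j) b'))
      (fun y' b => cubeT F κ ℓ k Ωc K At j (inclY (subLabels_subset Ωc K j) y')
        (incl (one_le_n ℓ k) (subLabels_subset Ωc K j) b))
      = covOp (regWt ((ℓ + 1) ^ k) (fineDom ((ℓ + 1) ^ k) (subLabels Ωc K j))) m2 a'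
          (rBlkWt ((ℓ + 1) ^ k) (subLabels Ωc K j) (fineDom ((ℓ + 1) ^ k) (subLabels Ωc K j)))
          (fieldLink F κ (subFieldI ℓ k Ωc K At j))
          (contourTrans (fieldLink F κ (subFieldI ℓ k Ωc K At j)) (rbaseEmb (one_le_n ℓ k) (subLabels Ωc K j))
            (rstairContour (one_le_n ℓ k) (subLabels Ωc K j))) := by
  have hW : (fun b b' => cubeW F κ ℓ k Ωc K At j (incl (one_le_n ℓ k) (subLabels_subset Ωc K j) b)
      (incl (one_le_n ℓ k) (subLabels_subset Ωc K j) b')) = fieldLink F κ (subFieldI ℓ k Ωc K At j) := by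
    funext b b'
    show (if cubeS ℓ k Ωc K j _ ∧ cubeS ℓ k Ωc K j _ then _ else _) = _
    rw [if_pos ⟨cubeS_incl ℓ k Ωc K j b, cubeS_incl ℓ k Ωc K j b'⟩]
    rfl
  have hT : (fun y' b => cubeT F κ ℓ k Ωc K At j (inclY (subLabels_subset Ωc K j) y')
      (incl (one_le_n ℓ k) (subLabels_subset Ωc K j) b))
      = contourTrans (fieldLink F κ (subFieldI ℓ k Ωc K At j)) (rbaseEmb (one_le_n ℓ k) (subLabels Ωc K j))
          (rstairContour (one_le_n ℓ k) (subLabels Ωc K j)) := by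
    funext y' b
    show (if cubeS ℓ k Ωc K j _ then _ else _) = _
    rw [if_pos (cubeS_incl ℓ k Ωc K j b)]
    exact contourTrans_incl (one_le_n ℓ k) (subLabels_subset Ωc K j) F κ At y' b
  rw [hW, hT]
  rfl

/-- **THE CUBE PROPAGATOR AT A BOUNDARY CUBE**: `G_j = pad_incl(G_k(Ω ∩ □̂_j, Ã_j)) + cinv` — the Green's function of the
sub-region (which exists for every configuration), zero-padded, plus the harmless diagonal off the cube.
[cite: Balaban1983RegularityDecay, (2.2) p.575 «if □_j intersects the boundary of Ω, then A_j = A»] -/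
def cubeGreenI (m2 a' : ℝ) (At : ↥(fineDom ((ℓ + 1) ^ k) Ωc) → ↥(fineDom ((ℓ + 1) ^ k) Ωc) → ℝ)
    (j : Fin (d + 1) → ℤ) : Matrix (↥(fineDom ((ℓ + 1) ^ k) Ωc) × ι) (↥(fineDom ((ℓ + 1) ^ k) Ωc) × ι) ℝ :=
  pad (incl (one_le_n ℓ k) (subLabels_subset Ωc K j))
      (covOp (regWt ((ℓ + 1) ^ k) (fineDom ((ℓ + 1) ^ k) (subLabels Ωc K j))) m2 a'
          (rBlkWt ((ℓ + 1) ^ k) (subLabels Ωc K j) (fineDom ((ℓ + 1) ^ k) (subLabels Ωc K j)))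
          (fieldLink F κ (subFieldI ℓ k Ωc K At j))
          (contourTrans (fieldLink F κ (subFieldI ℓ k Ωc K At j)) (rbaseEmb (one_le_n ℓ k) (subLabels Ωc K j))
            (rstairContour (one_le_n ℓ k) (subLabels Ωc K j))))⁻¹
    + cinv (cubeS ℓ k Ωc K j) (regWt ((ℓ + 1) ^ k) (fineDom ((ℓ + 1) ^ k) Ωc)) m2

/-- **THE HYPOTHESIS `hGj` OF THE GENERAL-`Ω` CHAIN AT EVERY CUBE, EVERY CONFIGURATION**: the Neumann-cut cube operator
(bond weights of `Ω` cut at `∂S_j`, cube links/transporters of `Ã_j`, null off the cube) times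
`G_j = pad_incl(G_k(Ω ∩ □̂_j, Ã_j)) + cinv` is the identity — `a′ > 0`, `m² ≥ 0`, mesh `n ≥ 2`; NO regularity or
smallness of `Ã_j` (the sub-region operator is positive definite: `B4WalkRouteRegion.covOp_blockLocal_posDef`).
[cite: Balaban1983RegularityDecay, (2.2) p.575, (2.6) p.576] -/
theorem cubeOp_mul_cubeGreenI {m2 a' : ℝ} (ha' : 0 < a') (hm : 0 ≤ m2) (hn2 : 2 ≤ (ℓ + 1) ^ k)
    (At : ↥(fineDom ((ℓ + 1) ^ k) Ωc) → ↥(fineDom ((ℓ + 1) ^ k) Ωc) → ℝ) (j : Fin (d + 1) → ℤ) :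
    covOp (cutWt (cubeS ℓ k Ωc K j) (regWt ((ℓ + 1) ^ k) (fineDom ((ℓ + 1) ^ k) Ωc))) m2 a'
        (rBlkWt ((ℓ + 1) ^ k) Ωc (fineDom ((ℓ + 1) ^ k) Ωc)) (cubeW F κ ℓ k Ωc K At j) (cubeT F κ ℓ k Ωc K At j)
      * cubeGreenI F κ ℓ k Ωc K m2 a' At j = 1 := by
  have hn := one_le_n ℓ k
  have hn0 : (0 : ℝ) < ((((ℓ + 1) ^ k : ℕ) : ℝ)) := by exact_mod_cast hn
  refine covOp_cut_mul_padInv (cubeS ℓ k Ωc K j) (incl_injective hn (subLabels_subset Ωc K j))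
    (cubeS_iff_incl ℓ k Ωc K j) (inclY_injective (subLabels_subset Ωc K j)) _ m2 _ _ _ _
    (fun y b h => rBlkWt_incl_ne_zero hn (subLabels_subset Ωc K j) h)
    (fun y z z' h h' => inBox_iff_of_rBlkWt _ _ h h') (fun z z' hz _ => ?_) (fun y z hz _ => ?_)
    (fun z hz => ?_) ?_
  · exact if_neg (fun h : cubeS ℓ k Ωc K j z ∧ cubeS ℓ k Ωc K j z' => hz h.1)
  · exact if_neg hz
  · have := cdeg_ge ℓ k Ωc hn2 (cshift K j) (fun _ => 2 * K) hz
    have : (0 : ℝ) < ((((ℓ + 1) ^ k : ℕ) : ℝ)) ^ 2 / 2 := by positivity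
    linarith
  · rw [subData_eq_incl]
    have hpd := covOp_blockLocal_posDef hn (subLabels Ωc K j) F κ ha' hm
      (regWt ((ℓ + 1) ^ k) (fineDom ((ℓ + 1) ^ k) (subLabels Ωc K j))) (regWt_nonneg _ _) (fun _ _ _ => rfl)
      (subFieldI ℓ k Ωc K At j)
    exact Matrix.mul_nonsing_inv _ ((Matrix.isUnit_iff_isUnit_det _).mp hpd.isUnit)

/-- **THE LETTER `K_jG_jh_j` (2.11) AT A BOUNDARY CUBE** is the padded sub-region letter
`K_{h_j|}·G_k(Ω ∩ □̂_j, Ã_j|)·h_j|` — the object of `B4Eq221HjRegion.eq221_l2_region_hZ` (Lemma 2.1's `‖·‖_{2,2}` factor);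
`supp h ⊆ □_j`. [cite: Balaban1983RegularityDecay, (2.11) p.576, (2.21) p.578 «‖K_{ω_i}G_k(□_{ω_i},Ã_{ω_i})h_{ω_i}‖_{2,2}»] -/
theorem cube_letter_b_I (m2 a' : ℝ) (At : ↥(fineDom ((ℓ + 1) ^ k) Ωc) → ↥(fineDom ((ℓ + 1) ^ k) Ωc) → ℝ)
    (j : Fin (d + 1) → ℤ) (h : ↥(fineDom ((ℓ + 1) ^ k) Ωc) → ℝ) (hh : ∀ z, h z ≠ 0 → cubeS ℓ k Ωc K j z) :
    opK (cutWt (cubeS ℓ k Ωc K j) (regWt ((ℓ + 1) ^ k) (fineDom ((ℓ + 1) ^ k) Ωc))) m2 a'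
        (rBlkWt ((ℓ + 1) ^ k) Ωc (fineDom ((ℓ + 1) ^ k) Ωc)) (cubeW F κ ℓ k Ωc K At j) (cubeT F κ ℓ k Ωc K At j) h
      * cubeGreenI F κ ℓ k Ωc K m2 a' At j * mulH (ι := ι) h
      = pad (incl (one_le_n ℓ k) (subLabels_subset Ωc K j))
          (opK (regWt ((ℓ + 1) ^ k) (fineDom ((ℓ + 1) ^ k) (subLabels Ωc K j))) m2 a'
              (rBlkWt ((ℓ + 1) ^ k) (subLabels Ωc K j) (fineDom ((ℓ + 1) ^ k) (subLabels Ωc K j)))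
              (fieldLink F κ (subFieldI ℓ k Ωc K At j))
              (contourTrans (fieldLink F κ (subFieldI ℓ k Ωc K At j)) (rbaseEmb (one_le_n ℓ k) (subLabels Ωc K j))
                (rstairContour (one_le_n ℓ k) (subLabels Ωc K j)))
              (fun a => h (incl (one_le_n ℓ k) (subLabels_subset Ωc K j) a))
            * (covOp (regWt ((ℓ + 1) ^ k) (fineDom ((ℓ + 1) ^ k) (subLabels Ωc K j))) m2 a'
                (rBlkWt ((ℓ + 1) ^ k) (subLabels Ωc K j) (fineDom ((ℓ + 1) ^ k) (subLabels Ωc K j)))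
                (fieldLink F κ (subFieldI ℓ k Ωc K At j))
                (contourTrans (fieldLink F κ (subFieldI ℓ k Ωc K At j)) (rbaseEmb (one_le_n ℓ k) (subLabels Ωc K j))
                  (rstairContour (one_le_n ℓ k) (subLabels Ωc K j))))⁻¹
            * mulH (ι := ι) (fun a => h (incl (one_le_n ℓ k) (subLabels_subset Ωc K j) a))) := by
  have hn := one_le_n ℓ k
  have hmain := letter_b_eq_pad (cubeS ℓ k Ωc K j) (incl_injective hn (subLabels_subset Ωc K j))
    (cubeS_iff_incl ℓ k Ωc K j) (inclY_injective (subLabels_subset Ωc K j))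
    (regWt ((ℓ + 1) ^ k) (fineDom ((ℓ + 1) ^ k) Ωc)) m2 a' (rBlkWt ((ℓ + 1) ^ k) Ωc (fineDom ((ℓ + 1) ^ k) Ωc))
    (cubeW F κ ℓ k Ωc K At j) (cubeT F κ ℓ k Ωc K At j)
    (fun y b h => rBlkWt_incl_ne_zero hn (subLabels_subset Ωc K j) h)
    (fun y z z' h h' => inBox_iff_of_rBlkWt _ _ h h')
    (fun z z' hz _ => if_neg (fun h : cubeS ℓ k Ωc K j z ∧ cubeS ℓ k Ωc K j z' => hz h.1))
    (fun y z hz _ => if_neg hz) h hh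
    ((covOp (regWt ((ℓ + 1) ^ k) (fineDom ((ℓ + 1) ^ k) (subLabels Ωc K j))) m2 a'
        (rBlkWt ((ℓ + 1) ^ k) (subLabels Ωc K j) (fineDom ((ℓ + 1) ^ k) (subLabels Ωc K j)))
        (fieldLink F κ (subFieldI ℓ k Ωc K At j))
        (contourTrans (fieldLink F κ (subFieldI ℓ k Ωc K At j)) (rbaseEmb (one_le_n ℓ k) (subLabels Ωc K j))
          (rstairContour (one_le_n ℓ k) (subLabels Ωc K j))))⁻¹)
  rw [cubeGreenI, hmain]
  have hW : (fun b b' => cubeW F κ ℓ k Ωc K At j (incl (one_le_n ℓ k) (subLabels_subset Ωc K j) b)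
      (incl (one_le_n ℓ k) (subLabels_subset Ωc K j) b')) = fieldLink F κ (subFieldI ℓ k Ωc K At j) := by
    funext b b'
    show (if cubeS ℓ k Ωc K j _ ∧ cubeS ℓ k Ωc K j _ then _ else _) = _
    rw [if_pos ⟨cubeS_incl ℓ k Ωc K j b, cubeS_incl ℓ k Ωc K j b'⟩]
    rfl
  have hT : (fun y' b => cubeT F κ ℓ k Ωc K At j (inclY (subLabels_subset Ωc K j) y')
      (incl (one_le_n ℓ k) (subLabels_subset Ωc K j) b))
      = contourTrans (fieldLink F κ (subFieldI ℓ k Ωc K At j)) (rbaseEmb (one_le_n ℓ k) (subLabels Ωc K j))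
          (rstairContour (one_le_n ℓ k) (subLabels Ωc K j)) := by
    funext y' b
    show (if cubeS ℓ k Ωc K j _ then _ else _) = _
    rw [if_pos (cubeS_incl ℓ k Ωc K j b)]
    exact contourTrans_incl (one_le_n ℓ k) (subLabels_subset Ωc K j) F κ At y' b
  rw [hW, hT]
  rfl

/-! ## §3. Interior cubes as translated boxes: the carrier of Lemma 2.2 -/

/-- the cube configuration seen on the translated box's own carrier (`□ = [0, 2nK)^{d+1}`, corner `K(j−1)`).
[cite: Balaban1983RegularityDecay, §2 p.575 «□_j is a cube of the size 2M», dictionary] -/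
abbrev subFieldB {j : Fin (d + 1) → ℤ} (hgood : cubeLabels K j ⊆ Ωc)
    (At : ↥(fineDom ((ℓ + 1) ^ k) Ωc) → ↥(fineDom ((ℓ + 1) ^ k) Ωc) → ℝ) :
    ↥(Box d ℓ k fun _ => 2 * K) → ↥(Box d ℓ k fun _ => 2 * K) → ℝ :=
  fun a b => At (boxEmb ℓ k (fun _ => 2 * K) (cshift K j) (shift_mem_of_cube_subset hgood) a)
    (boxEmb ℓ k (fun _ => 2 * K) (cshift K j) (shift_mem_of_cube_subset hgood) b)

omit [Fintype ι] [DecidableEq ι] in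
/-- the image of the translated box is the cube's site set. [cite: Balaban1983RegularityDecay, §2 p.575] -/
theorem cubeS_iff_boxEmb {j : Fin (d + 1) → ℤ} (hgood : cubeLabels K j ⊆ Ωc) (x : ↥(fineDom ((ℓ + 1) ^ k) Ωc)) :
    cubeS ℓ k Ωc K j x ↔ ∃ a, boxEmb ℓ k (fun _ => 2 * K) (cshift K j) (shift_mem_of_cube_subset hgood) a = x :=
  inBox_iff ℓ k (fun _ => 2 * K) (cshift K j) (shift_mem_of_cube_subset hgood) x

omit [Fintype ι] [DecidableEq ι] in
/-- an embedded box site lies in the cube's site set. [cite: Balaban1983RegularityDecay, §2 p.575] -/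
theorem cubeS_boxEmb {j : Fin (d + 1) → ℤ} (hgood : cubeLabels K j ⊆ Ωc) (a : ↥(Box d ℓ k fun _ => 2 * K)) :
    cubeS ℓ k Ωc K j (boxEmb ℓ k (fun _ => 2 * K) (cshift K j) (shift_mem_of_cube_subset hgood) a) :=
  (cubeS_iff_boxEmb ℓ k Ωc K hgood _).mpr ⟨a, rfl⟩

/-- **THE RESTRICTED CUT DATA AT AN INTERIOR CUBE ARE THE LINEAGE's `opA` ON THE `2K`-BOX** with the restricted field
(print (2.6); running coefficient `a_kη^{d+1}`): the operator `H_k(□_j, Ã_j)` whose inverse is `greenA` = `G_k(□_j, Ã_j)`.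
[cite: Balaban1983RegularityDecay, (2.6) p.576, (2.2) p.575, (1.6) p.572] -/
theorem subData_eq_box (a m2 : ℝ) (At : ↥(fineDom ((ℓ + 1) ^ k) Ωc) → ↥(fineDom ((ℓ + 1) ^ k) Ωc) → ℝ)
    {j : Fin (d + 1) → ℤ} (hgood : cubeLabels K j ⊆ Ωc) :
    covOp (fun b b' => regWt ((ℓ + 1) ^ k) (fineDom ((ℓ + 1) ^ k) Ωc)
        (boxEmb ℓ k (fun _ => 2 * K) (cshift K j) (shift_mem_of_cube_subset hgood) b)
        (boxEmb ℓ k (fun _ => 2 * K) (cshift K j) (shift_mem_of_cube_subset hgood) b')) m2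
      (B1.aSeq a ((ℓ : ℝ) + 1) k * (((((ℓ + 1) ^ k : ℕ)) : ℝ) ^ (d + 1))⁻¹)
      (fun y' b => rBlkWt ((ℓ + 1) ^ k) Ωc (fineDom ((ℓ + 1) ^ k) Ωc)
        (boxEmbY (fun _ => 2 * K) (cshift K j) (shift_mem_of_cube_subset hgood) y')
        (boxEmb ℓ k (fun _ => 2 * K) (cshift K j) (shift_mem_of_cube_subset hgood) b))
      (fun b b' => cubeW F κ ℓ k Ωc K At j
        (boxEmb ℓ k (fun _ => 2 * K) (cshift K j) (shift_mem_of_cube_subset hgood) b)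
        (boxEmb ℓ k (fun _ => 2 * K) (cshift K j) (shift_mem_of_cube_subset hgood) b'))
      (fun y' b => cubeT F κ ℓ k Ωc K At j
        (boxEmbY (fun _ => 2 * K) (cshift K j) (shift_mem_of_cube_subset hgood) y')
        (boxEmb ℓ k (fun _ => 2 * K) (cshift K j) (shift_mem_of_cube_subset hgood) b))
      = opA d F κ ℓ k a m2 (fun _ => 2 * K) (baseEmb (one_le_n ℓ k) _) (stairContour (one_le_n ℓ k) _)
          (subFieldB ℓ k Ωc K hgood At) := by
  have hc : (fun b b' => regWt ((ℓ + 1) ^ k) (fineDom ((ℓ + 1) ^ k) Ωc)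
      (boxEmb ℓ k (fun _ => 2 * K) (cshift K j) (shift_mem_of_cube_subset hgood) b)
      (boxEmb ℓ k (fun _ => 2 * K) (cshift K j) (shift_mem_of_cube_subset hgood) b'))
      = boxWt ((ℓ + 1) ^ k) (fun i => (ℓ + 1) ^ k * (fun _ : Fin (d + 1) => 2 * K) i) := by
    funext b b'
    exact regWt_boxEmb ℓ k (fun _ => 2 * K) (cshift K j) (shift_mem_of_cube_subset hgood) b b'
  have hq : (fun y' b => rBlkWt ((ℓ + 1) ^ k) Ωc (fineDom ((ℓ + 1) ^ k) Ωc)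
      (boxEmbY (fun _ => 2 * K) (cshift K j) (shift_mem_of_cube_subset hgood) y')
      (boxEmb ℓ k (fun _ => 2 * K) (cshift K j) (shift_mem_of_cube_subset hgood) b))
      = blkWt ((ℓ + 1) ^ k) (fun _ => 2 * K) (fun i => (ℓ + 1) ^ k * (fun _ : Fin (d + 1) => 2 * K) i) := by
    funext y' b
    exact rBlkWt_boxEmb ℓ k (fun _ => 2 * K) (cshift K j) (shift_mem_of_cube_subset hgood) y' b
  have hW : (fun b b' => cubeW F κ ℓ k Ωc K At j
      (boxEmb ℓ k (fun _ => 2 * K) (cshift K j) (shift_mem_of_cube_subset hgood) b)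
      (boxEmb ℓ k (fun _ => 2 * K) (cshift K j) (shift_mem_of_cube_subset hgood) b'))
      = fieldLink F κ (subFieldB ℓ k Ωc K hgood At) := by
    funext b b'
    show (if cubeS ℓ k Ωc K j _ ∧ cubeS ℓ k Ωc K j _ then _ else _) = _
    rw [if_pos ⟨cubeS_boxEmb ℓ k Ωc K hgood b, cubeS_boxEmb ℓ k Ωc K hgood b'⟩]
    rfl
  have hT : (fun y' b => cubeT F κ ℓ k Ωc K At j
      (boxEmbY (fun _ => 2 * K) (cshift K j) (shift_mem_of_cube_subset hgood) y')
      (boxEmb ℓ k (fun _ => 2 * K) (cshift K j) (shift_mem_of_cube_subset hgood) b))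
      = contourTrans (fieldLink F κ (subFieldB ℓ k Ωc K hgood At)) (baseEmb (one_le_n ℓ k) _)
          (stairContour (one_le_n ℓ k) _) := by
    funext y' b
    show (if cubeS ℓ k Ωc K j _ then _ else _) = _
    rw [if_pos (cubeS_boxEmb ℓ k Ωc K hgood b)]
    exact contourTrans_boxEmb ℓ k (fun _ => 2 * K) (cshift K j) (shift_mem_of_cube_subset hgood) F κ At y' b
  rw [hc, hq, hW, hT]
  rfl

/-- **THE CUBE PROPAGATOR AT AN INTERIOR CUBE**: `G_j = pad_boxEmb(G_k(□_j, Ã_j)) + cinv` with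
`G_k(□_j, Ã_j) = B4Lemma22ReduceZero.greenA` on the translated box's own carrier.
[cite: Balaban1983RegularityDecay, (2.2) p.575 «if □_j is an interior cube of Ω …»] -/
def cubeGreenB (a m2 : ℝ) (At : ↥(fineDom ((ℓ + 1) ^ k) Ωc) → ↥(fineDom ((ℓ + 1) ^ k) Ωc) → ℝ)
    {j : Fin (d + 1) → ℤ} (hgood : cubeLabels K j ⊆ Ωc) :
    Matrix (↥(fineDom ((ℓ + 1) ^ k) Ωc) × ι) (↥(fineDom ((ℓ + 1) ^ k) Ωc) × ι) ℝ :=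
  pad (boxEmb ℓ k (fun _ => 2 * K) (cshift K j) (shift_mem_of_cube_subset hgood))
      (greenA d F κ ℓ k a m2 (fun _ => 2 * K) (baseEmb (one_le_n ℓ k) _) (stairContour (one_le_n ℓ k) _)
        (subFieldB ℓ k Ωc K hgood At))
    + cinv (cubeS ℓ k Ωc K j) (regWt ((ℓ + 1) ^ k) (fineDom ((ℓ + 1) ^ k) Ωc)) m2

/-- **THE HYPOTHESIS `hGj` AT AN INTERIOR CUBE, FOR EVERY CUBE FIELD**: the Neumann-cut cube operator with the running
coefficient `a_kη^{d+1}` times `G_j = pad(greenA(Ã_□)) + cinv` is the identity — `a > 0`, `m² ≥ 0`, `L ≥ 2`, `k ≥ 1`;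
NO regularity or smallness of `Ã` (`B4Lemma22Invertible.opA_stair_isUnit_det`).
[cite: Balaban1983RegularityDecay, (2.2) p.575, (2.6) p.576] -/
theorem cubeOp_mul_cubeGreenB (hℓ : 1 ≤ ℓ) (hk : 1 ≤ k) {a m2 : ℝ} (ha : 0 < a) (hm : 0 ≤ m2)
    (At : ↥(fineDom ((ℓ + 1) ^ k) Ωc) → ↥(fineDom ((ℓ + 1) ^ k) Ωc) → ℝ) {j : Fin (d + 1) → ℤ}
    (hgood : cubeLabels K j ⊆ Ωc) :
    covOp (cutWt (cubeS ℓ k Ωc K j) (regWt ((ℓ + 1) ^ k) (fineDom ((ℓ + 1) ^ k) Ωc))) m2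
        (B1.aSeq a ((ℓ : ℝ) + 1) k * (((((ℓ + 1) ^ k : ℕ)) : ℝ) ^ (d + 1))⁻¹)
        (rBlkWt ((ℓ + 1) ^ k) Ωc (fineDom ((ℓ + 1) ^ k) Ωc)) (cubeW F κ ℓ k Ωc K At j) (cubeT F κ ℓ k Ωc K At j)
      * cubeGreenB F κ ℓ k Ωc K a m2 At hgood = 1 := by
  have hn := one_le_n ℓ k
  have hn2 : 2 ≤ (ℓ + 1) ^ k := by
    calc 2 ≤ ℓ + 1 := by omega
      _ = (ℓ + 1) ^ 1 := (pow_one _).symm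
      _ ≤ (ℓ + 1) ^ k := Nat.pow_le_pow_right (Nat.succ_pos ℓ) hk
  have hn0 : (0 : ℝ) < ((((ℓ + 1) ^ k : ℕ) : ℝ)) := by exact_mod_cast hn
  refine covOp_cut_mul_padInv (cubeS ℓ k Ωc K j)
    (boxEmb_injective ℓ k (fun _ => 2 * K) (cshift K j) (shift_mem_of_cube_subset hgood))
    (cubeS_iff_boxEmb ℓ k Ωc K hgood)
    (boxEmbY_injective (fun _ => 2 * K) (cshift K j) (shift_mem_of_cube_subset hgood)) _ m2 _ _ _ _
    (fun y b h => rBlkWt_boxEmb_ne_zero ℓ k (fun _ => 2 * K) (cshift K j) (shift_mem_of_cube_subset hgood) h)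
    (fun y z z' h h' => inBox_iff_of_rBlkWt _ _ h h') (fun z z' hz _ => ?_) (fun y z hz _ => ?_)
    (fun z hz => ?_) ?_
  · exact if_neg (fun h : cubeS ℓ k Ωc K j z ∧ cubeS ℓ k Ωc K j z' => hz h.1)
  · exact if_neg hz
  · have := cdeg_ge ℓ k Ωc hn2 (cshift K j) (fun _ => 2 * K) hz
    have : (0 : ℝ) < ((((ℓ + 1) ^ k : ℕ) : ℝ)) ^ 2 / 2 := by positivity
    linarith
  · rw [subData_eq_box]
    exact Matrix.mul_nonsing_inv _ (opA_stair_isUnit_det F κ hℓ hk hn ha hm _ _)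

/-- **THE INPUT `γ` AT AN INTERIOR CUBE**: `‖G_j‖_{ℓ∞→ℓ∞} ≤ max ‖greenA(Ã_□)‖ (2/n²)` — the sup-operator-norm of the
chain's cube propagator is that of `G_k(□_j, Ã_j)` on the `2K`-box (Lemma 2.2 (2.17), `p = q = ∞`), up to the harmless
diagonal off the cube (`n ≥ 2`). [cite: Balaban1983RegularityDecay, (2.17) p.578, (2.20) p.578] -/
theorem norm_cubeGreenB_le (hn2 : 2 ≤ (ℓ + 1) ^ k) (a : ℝ) {m2 : ℝ} (hm : 0 ≤ m2)
    (At : ↥(fineDom ((ℓ + 1) ^ k) Ωc) → ↥(fineDom ((ℓ + 1) ^ k) Ωc) → ℝ) {j : Fin (d + 1) → ℤ}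
    (hgood : cubeLabels K j ⊆ Ωc) :
    ‖cubeGreenB F κ ℓ k Ωc K a m2 At hgood‖
      ≤ max ‖greenA d F κ ℓ k a m2 (fun _ => 2 * K) (baseEmb (one_le_n ℓ k) _) (stairContour (one_le_n ℓ k) _)
            (subFieldB ℓ k Ωc K hgood At)‖ (2 / ((((ℓ + 1) ^ k : ℕ) : ℝ)) ^ 2) := by
  have hn := one_le_n ℓ k
  have hn0 : (0 : ℝ) < ((((ℓ + 1) ^ k : ℕ) : ℝ)) := by exact_mod_cast hn
  have hm₀ : (0 : ℝ) < ((((ℓ + 1) ^ k : ℕ) : ℝ)) ^ 2 / 2 := by positivity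
  have h := norm_padInv_le (cubeS ℓ k Ωc K j)
    (boxEmb_injective ℓ k (fun _ => 2 * K) (cshift K j) (shift_mem_of_cube_subset hgood))
    (cubeS_iff_boxEmb ℓ k Ωc K hgood) (regWt ((ℓ + 1) ^ k) (fineDom ((ℓ + 1) ^ k) Ωc)) m2 hm₀
    (fun z hz => by have := cdeg_ge ℓ k Ωc hn2 (cshift K j) (fun _ => 2 * K) hz; linarith)
    (greenA d F κ ℓ k a m2 (fun _ => 2 * K) (baseEmb (one_le_n ℓ k) _) (stairContour (one_le_n ℓ k) _)
      (subFieldB ℓ k Ωc K hgood At))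
  rw [show (2 : ℝ) / ((((ℓ + 1) ^ k : ℕ) : ℝ)) ^ 2 = (((((ℓ + 1) ^ k : ℕ) : ℝ)) ^ 2 / 2)⁻¹ by rw [inv_div]]
  exact h

/-- **THE LETTER `K_jG_jh_j` (2.11) AT AN INTERIOR CUBE** built from the cut operator and `G_j` is the padded box letter
`K_{h_□}·greenA(Ã_□)·h_□` with `K_{h_□} = opK c_□ m2 (a_kη^{d+1}) q_□ (links of Ã_□) (transporters of Ã_□) h_□`
(= `B4Eq220CommutatorField.kOp F κ n a_k m2 (2K) baseEmb stairContour Ã_□ h_□`, definitionally) — so **the inputs of the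
chain at the interior cubes are the box's factor bounds (2.20)/(2.21)** (p35's `B4Eq220CubeField`).
[cite: Balaban1983RegularityDecay, (2.11) p.576, (2.20)–(2.21) p.578] -/
theorem cube_letter_b_B (a m2 : ℝ) (At : ↥(fineDom ((ℓ + 1) ^ k) Ωc) → ↥(fineDom ((ℓ + 1) ^ k) Ωc) → ℝ)
    {j : Fin (d + 1) → ℤ} (hgood : cubeLabels K j ⊆ Ωc) (h : ↥(fineDom ((ℓ + 1) ^ k) Ωc) → ℝ)
    (hh : ∀ z, h z ≠ 0 → cubeS ℓ k Ωc K j z) :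
    opK (cutWt (cubeS ℓ k Ωc K j) (regWt ((ℓ + 1) ^ k) (fineDom ((ℓ + 1) ^ k) Ωc))) m2
        (B1.aSeq a ((ℓ : ℝ) + 1) k * (((((ℓ + 1) ^ k : ℕ)) : ℝ) ^ (d + 1))⁻¹)
        (rBlkWt ((ℓ + 1) ^ k) Ωc (fineDom ((ℓ + 1) ^ k) Ωc)) (cubeW F κ ℓ k Ωc K At j) (cubeT F κ ℓ k Ωc K At j) h
      * cubeGreenB F κ ℓ k Ωc K a m2 At hgood * mulH (ι := ι) h
      = pad (boxEmb ℓ k (fun _ => 2 * K) (cshift K j) (shift_mem_of_cube_subset hgood))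
          (opK (boxWt ((ℓ + 1) ^ k) (fun i => (ℓ + 1) ^ k * (fun _ : Fin (d + 1) => 2 * K) i)) m2
              (B1.aSeq a ((ℓ : ℝ) + 1) k * (((((ℓ + 1) ^ k : ℕ)) : ℝ) ^ (d + 1))⁻¹)
              (blkWt ((ℓ + 1) ^ k) (fun _ => 2 * K) (fun i => (ℓ + 1) ^ k * (fun _ : Fin (d + 1) => 2 * K) i))
              (fieldLink F κ (subFieldB ℓ k Ωc K hgood At))
              (contourTrans (fieldLink F κ (subFieldB ℓ k Ωc K hgood At)) (baseEmb (one_le_n ℓ k) _)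
                (stairContour (one_le_n ℓ k) _))
              (fun b => h (boxEmb ℓ k (fun _ => 2 * K) (cshift K j) (shift_mem_of_cube_subset hgood) b))
            * greenA d F κ ℓ k a m2 (fun _ => 2 * K) (baseEmb (one_le_n ℓ k) _) (stairContour (one_le_n ℓ k) _)
                (subFieldB ℓ k Ωc K hgood At)
            * mulH (ι := ι) (fun b => h (boxEmb ℓ k (fun _ => 2 * K) (cshift K j)
                (shift_mem_of_cube_subset hgood) b))) := by
  have hn := one_le_n ℓ k
  have hmain := letter_b_eq_pad (cubeS ℓ k Ωc K j)
    (boxEmb_injective ℓ k (fun _ => 2 * K) (cshift K j) (shift_mem_of_cube_subset hgood))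
    (cubeS_iff_boxEmb ℓ k Ωc K hgood)
    (boxEmbY_injective (fun _ => 2 * K) (cshift K j) (shift_mem_of_cube_subset hgood))
    (regWt ((ℓ + 1) ^ k) (fineDom ((ℓ + 1) ^ k) Ωc)) m2
    (B1.aSeq a ((ℓ : ℝ) + 1) k * (((((ℓ + 1) ^ k : ℕ)) : ℝ) ^ (d + 1))⁻¹)
    (rBlkWt ((ℓ + 1) ^ k) Ωc (fineDom ((ℓ + 1) ^ k) Ωc)) (cubeW F κ ℓ k Ωc K At j) (cubeT F κ ℓ k Ωc K At j)
    (fun y b h => rBlkWt_boxEmb_ne_zero ℓ k (fun _ => 2 * K) (cshift K j) (shift_mem_of_cube_subset hgood) h)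
    (fun y z z' h h' => inBox_iff_of_rBlkWt _ _ h h')
    (fun z z' hz _ => if_neg (fun h : cubeS ℓ k Ωc K j z ∧ cubeS ℓ k Ωc K j z' => hz h.1))
    (fun y z hz _ => if_neg hz) h hh
    (greenA d F κ ℓ k a m2 (fun _ => 2 * K) (baseEmb (one_le_n ℓ k) _) (stairContour (one_le_n ℓ k) _)
      (subFieldB ℓ k Ωc K hgood At))
  rw [cubeGreenB, hmain]
  have hc : (fun b b' => regWt ((ℓ + 1) ^ k) (fineDom ((ℓ + 1) ^ k) Ωc)
      (boxEmb ℓ k (fun _ => 2 * K) (cshift K j) (shift_mem_of_cube_subset hgood) b)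
      (boxEmb ℓ k (fun _ => 2 * K) (cshift K j) (shift_mem_of_cube_subset hgood) b'))
      = boxWt ((ℓ + 1) ^ k) (fun i => (ℓ + 1) ^ k * (fun _ : Fin (d + 1) => 2 * K) i) := by
    funext b b'
    exact regWt_boxEmb ℓ k (fun _ => 2 * K) (cshift K j) (shift_mem_of_cube_subset hgood) b b'
  have hq : (fun y' b => rBlkWt ((ℓ + 1) ^ k) Ωc (fineDom ((ℓ + 1) ^ k) Ωc)
      (boxEmbY (fun _ => 2 * K) (cshift K j) (shift_mem_of_cube_subset hgood) y')
      (boxEmb ℓ k (fun _ => 2 * K) (cshift K j) (shift_mem_of_cube_subset hgood) b))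
      = blkWt ((ℓ + 1) ^ k) (fun _ => 2 * K) (fun i => (ℓ + 1) ^ k * (fun _ : Fin (d + 1) => 2 * K) i) := by
    funext y' b
    exact rBlkWt_boxEmb ℓ k (fun _ => 2 * K) (cshift K j) (shift_mem_of_cube_subset hgood) y' b
  have hW : (fun b b' => cubeW F κ ℓ k Ωc K At j
      (boxEmb ℓ k (fun _ => 2 * K) (cshift K j) (shift_mem_of_cube_subset hgood) b)
      (boxEmb ℓ k (fun _ => 2 * K) (cshift K j) (shift_mem_of_cube_subset hgood) b'))
      = fieldLink F κ (subFieldB ℓ k Ωc K hgood At) := by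
    funext b b'
    show (if cubeS ℓ k Ωc K j _ ∧ cubeS ℓ k Ωc K j _ then _ else _) = _
    rw [if_pos ⟨cubeS_boxEmb ℓ k Ωc K hgood b, cubeS_boxEmb ℓ k Ωc K hgood b'⟩]
    rfl
  have hT : (fun y' b => cubeT F κ ℓ k Ωc K At j
      (boxEmbY (fun _ => 2 * K) (cshift K j) (shift_mem_of_cube_subset hgood) y')
      (boxEmb ℓ k (fun _ => 2 * K) (cshift K j) (shift_mem_of_cube_subset hgood) b))
      = contourTrans (fieldLink F κ (subFieldB ℓ k Ωc K hgood At)) (baseEmb (one_le_n ℓ k) _)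
          (stairContour (one_le_n ℓ k) _) := by
    funext y' b
    show (if cubeS ℓ k Ωc K j _ then _ else _) = _
    rw [if_pos (cubeS_boxEmb ℓ k Ωc K hgood b)]
    exact contourTrans_boxEmb ℓ k (fun _ => 2 * K) (cshift K j) (shift_mem_of_cube_subset hgood) F κ At y' b
  rw [hc, hq, hW, hT]

/-! ## §4. The plateau «Ã_j = A on {x : |x − Mj| ≤ ¾M}»: there the cube data ARE the data of `A` -/

omit [Fintype ι] [DecidableEq ι] in
/-- a site of the `¾M`-core of `□_j` (`M = nK`) lies in the cube's site set. [cite: Balaban1983RegularityDecay, §2 p.575] -/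
theorem cubeS_of_core {K : ℕ} (hK : 1 ≤ K) (j : Fin (d + 1) → ℤ) (x : ↥(fineDom ((ℓ + 1) ^ k) Ωc))
    (hx : ∀ μ, |rpos ((ℓ + 1) ^ k) Ωc x μ - ((((ℓ + 1) ^ k : ℕ) : ℝ) * K) * j μ|
      ≤ 3 / 4 * ((((ℓ + 1) ^ k : ℕ) : ℝ) * K)) : cubeS ℓ k Ωc K j x := by
  have hn := one_le_n ℓ k
  have hM : (0 : ℝ) ≤ (((ℓ + 1) ^ k : ℕ) : ℝ) * K := by positivity
  exact inBox_of_near hn hK j x fun μ => (hx μ).trans (by nlinarith)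

/-- **`hWW'` OF THE CHAIN**: on a pair of sites of the `¾M`-core where `Ã_j = A`, the cube link IS the link `U(κA_b)`
of the region's operator. [cite: Balaban1983RegularityDecay, §2 p.575 «we take Ã_j as equal to A on the cube
{x: |x − Mj| ≤ ¾M}», (1.2) p.572] -/
theorem cubeW_window {K : ℕ} (hK : 1 ≤ K)
    {At A : ↥(fineDom ((ℓ + 1) ^ k) Ωc) → ↥(fineDom ((ℓ + 1) ^ k) Ωc) → ℝ} (j : Fin (d + 1) → ℤ)
    {x z' : ↥(fineDom ((ℓ + 1) ^ k) Ωc)}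
    (hx : ∀ μ, |rpos ((ℓ + 1) ^ k) Ωc x μ - ((((ℓ + 1) ^ k : ℕ) : ℝ) * K) * j μ|
      ≤ 3 / 4 * ((((ℓ + 1) ^ k : ℕ) : ℝ) * K))
    (hz' : ∀ μ, |rpos ((ℓ + 1) ^ k) Ωc z' μ - ((((ℓ + 1) ^ k : ℕ) : ℝ) * K) * j μ|
      ≤ 3 / 4 * ((((ℓ + 1) ^ k : ℕ) : ℝ) * K))
    (hAt : At x z' = A x z') : cubeW F κ ℓ k Ωc K At j x z' = fieldLink F κ A x z' := by
  show (if cubeS ℓ k Ωc K j x ∧ cubeS ℓ k Ωc K j z' then _ else _) = _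
  rw [if_pos ⟨cubeS_of_core ℓ k Ωc hK j x hx, cubeS_of_core ℓ k Ωc hK j z' hz'⟩]
  unfold fieldLink
  rw [hAt]

omit [Fintype ι] [DecidableEq ι] in
/-- a path all of whose sites (start included) have a property steps between sites with the property. [folklore] -/
private theorem pathRel_ends {X : Type*} {r : X → X → Prop} {P : X → Prop} :
    ∀ (a : X) (l : List X), P a → (∀ z ∈ l, P z) → PathRel r a l → PathRel (fun u v => P u ∧ P v ∧ r u v) a l
  | _, [], _, _, _ => trivial
  | a, b :: l, ha, hl, h =>
      ⟨⟨ha, hl b (by simp), h.1⟩, pathRel_ends b l (hl b (by simp)) (fun z hz => hl z (by simp [hz])) h.2⟩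

omit [Fintype ι] [DecidableEq ι] in
/-- **THE STAIRCASE OF A CORE SITE RUNS IN THE CORE** (`4 ∣ K`): the contour `Γ_{y,x}` from the base corner `n·y` of
`B(y) ∋ x` to `x` is coordinatewise monotone, so for `x` in the `¾M`-core (`M = nK`, lower faces on the unit grid) all
its sites are in the `¾M`-core. [cite: Balaban1983RegularityDecay, p.572 «Γ^{(k)}_{y,x}», §2 p.575] -/
theorem rstairContour_core {n : ℕ} (hn : 1 ≤ n) {K : ℕ} (hK4 : 4 ∣ K) (j : Fin (d + 1) → ℤ) (y : ↥Ωc)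
    (x : ↥(fineDom n Ωc)) (hb : blk n x.1 = y.1)
    (hx : ∀ μ, |rpos n Ωc x μ - ((n : ℝ) * K) * j μ| ≤ 3 / 4 * ((n : ℝ) * K)) :
    PathRel (fun u v : ↥(fineDom n Ωc) =>
        (∀ μ, |rpos n Ωc u μ - ((n : ℝ) * K) * j μ| ≤ 3 / 4 * ((n : ℝ) * K)) ∧
        (∀ μ, |rpos n Ωc v μ - ((n : ℝ) * K) * j μ| ≤ 3 / 4 * ((n : ℝ) * K)) ∧ v.1 ∈ nbrs u.1)
      (rbaseEmb hn Ωc y) (rstairContour hn Ωc y x) := by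
  obtain ⟨K', hK'⟩ := hK4
  have hn0 : (0 : ℤ) < n := by exact_mod_cast hn
  have hKr : (K : ℝ) = 4 * K' := by exact_mod_cast hK'
  have hbase := base_le_of_blk hn hb
  -- the block label is at least `Kj_μ − 3K'` in every direction
  have hylow : ∀ μ, (n : ℝ) * (4 * (K' : ℝ) * j μ - 3 * K') ≤ (n : ℝ) * (y.1 μ : ℝ) := by
    intro μ
    have h1 := (abs_le.1 (hx μ)).1
    simp only [rpos, hKr] at h1
    have h2 : (((n : ℤ) * (4 * (K' : ℤ) * j μ - 3 * K') : ℤ) : ℝ) ≤ ((x.1 μ : ℤ) : ℝ) := by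
      push_cast
      have hid : (n : ℝ) * (4 * (K' : ℝ) * j μ - 3 * K')
          = (n : ℝ) * (4 * (K' : ℝ)) * j μ - 3 / 4 * ((n : ℝ) * (4 * (K' : ℝ))) := by ring
      linarith
    have h3 : (n : ℤ) * (4 * (K' : ℤ) * j μ - 3 * K') ≤ x.1 μ := by exact_mod_cast h2
    have h4 : 4 * (K' : ℤ) * j μ - 3 * K' ≤ y.1 μ := by
      rw [← hb]
      exact (Int.le_ediv_iff_mul_le hn0).2 (by rw [mul_comm]; exact h3)
    have h5 : (4 * (K' : ℝ) * j μ - 3 * K' : ℝ) ≤ (y.1 μ : ℝ) := by exact_mod_cast h4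
    have hnr : (0 : ℝ) ≤ (n : ℝ) := by positivity
    exact mul_le_mul_of_nonneg_left h5 hnr
  -- every lattice point between the base corner and `x` is in the core
  have hcore : ∀ w : ↥(fineDom n Ωc), (fun i => (n : ℤ) * y.1 i) ≤ w.1 → w.1 ≤ x.1 →
      ∀ μ, |rpos n Ωc w μ - ((n : ℝ) * K) * j μ| ≤ 3 / 4 * ((n : ℝ) * K) := by
    intro w hlo hhi μ
    have hup := (abs_le.1 (hx μ)).2
    simp only [rpos] at hup ⊢
    have h1 : ((n : ℤ) : ℝ) * (y.1 μ : ℝ) ≤ ((w.1 μ : ℤ) : ℝ) := by exact_mod_cast hlo μ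
    have h2 : ((w.1 μ : ℤ) : ℝ) ≤ ((x.1 μ : ℤ) : ℝ) := by exact_mod_cast hhi μ
    have h3 := hylow μ
    rw [abs_le]
    constructor
    · rw [hKr]
      push_cast at h1
      have hid : (n : ℝ) * (4 * (K' : ℝ) * j μ - 3 * K')
          = (n : ℝ) * (4 * (K' : ℝ)) * j μ - 3 / 4 * ((n : ℝ) * (4 * (K' : ℝ))) := by ring
      linarith
    · linarith
  unfold rstairContour
  rw [dif_pos hb]
  have hmem : ∀ z ∈ stair (fun i => (n : ℤ) * y.1 i) x.1, z ∈ fineDom n Ωc :=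
    B4Lower18RegularRegion.stair_mem_fineDom hn Ωc y x hb
  have key : PathRel (fun u v : Fin (d + 1) → ℤ =>
      (∀ h : u ∈ fineDom n Ωc, ∀ μ, |rpos n Ωc ⟨u, h⟩ μ - ((n : ℝ) * K) * j μ| ≤ 3 / 4 * ((n : ℝ) * K)) ∧
      (∀ h : v ∈ fineDom n Ωc, ∀ μ, |rpos n Ωc ⟨v, h⟩ μ - ((n : ℝ) * K) * j μ| ≤ 3 / 4 * ((n : ℝ) * K)) ∧
      v ∈ nbrs u) (fun i => (n : ℤ) * y.1 i) (stair (fun i => (n : ℤ) * y.1 i) x.1) :=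
    pathRel_ends (P := fun u : Fin (d + 1) → ℤ => ∀ h : u ∈ fineDom n Ωc,
        ∀ μ, |rpos n Ωc ⟨u, h⟩ μ - ((n : ℝ) * K) * j μ| ≤ 3 / 4 * ((n : ℝ) * K)) _ _
      (fun h => hcore ⟨_, h⟩ le_rfl hbase.1)
      (fun z hz h => hcore ⟨z, h⟩ (mem_stair hbase.1 hz).1 (mem_stair hbase.1 hz).2)
      (pathRel_stair hbase.1)
  have := (pathRel_pmap_iff (P := fun z => z ∈ fineDom n Ωc)
    (r := fun u v : Fin (d + 1) → ℤ =>
      (∀ h : u ∈ fineDom n Ωc, ∀ μ, |rpos n Ωc ⟨u, h⟩ μ - ((n : ℝ) * K) * j μ| ≤ 3 / 4 * ((n : ℝ) * K)) ∧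
      (∀ h : v ∈ fineDom n Ωc, ∀ μ, |rpos n Ωc ⟨v, h⟩ μ - ((n : ℝ) * K) * j μ| ≤ 3 / 4 * ((n : ℝ) * K)) ∧
      v ∈ nbrs u) _ _ (B4Lower18RegularRegion.base_mem_fineDom hn Ωc y) hmem).2 key
  exact B4Lower18RegularRegion.pathRel_mono (fun u v huv => ⟨huv.1 u.2, huv.2.1 v.2, huv.2.2⟩) _ _ this

/-- **`hTT'` OF THE CHAIN** (`4 ∣ K`): for `x ∈ B(y)` in the `¾M`-core, the cube transporter `U(Ã_j(Γ_{y,x}))` IS the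
region's transporter `U(A(Γ_{y,x}))` as soon as `Ã_j = A` on the nearest-neighbour bonds of the core (the staircase
`Γ_{y,x}` runs in the core). [cite: Balaban1983RegularityDecay, (1.4) p.572, §2 p.575 «Ã_j … equal to A on the cube
{x: |x − Mj| ≤ ¾M}»] -/
theorem cubeT_window {K : ℕ} (hK : 1 ≤ K) (hK4 : 4 ∣ K)
    {At A : ↥(fineDom ((ℓ + 1) ^ k) Ωc) → ↥(fineDom ((ℓ + 1) ^ k) Ωc) → ℝ} (j : Fin (d + 1) → ℤ)
    (hAt : ∀ u v : ↥(fineDom ((ℓ + 1) ^ k) Ωc),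
      (∀ μ, |rpos ((ℓ + 1) ^ k) Ωc u μ - ((((ℓ + 1) ^ k : ℕ) : ℝ) * K) * j μ|
        ≤ 3 / 4 * ((((ℓ + 1) ^ k : ℕ) : ℝ) * K)) →
      (∀ μ, |rpos ((ℓ + 1) ^ k) Ωc v μ - ((((ℓ + 1) ^ k : ℕ) : ℝ) * K) * j μ|
        ≤ 3 / 4 * ((((ℓ + 1) ^ k : ℕ) : ℝ) * K)) → v.1 ∈ nbrs u.1 → At u v = A u v)
    (y : ↥Ωc) (x : ↥(fineDom ((ℓ + 1) ^ k) Ωc))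
    (hyx : rBlkWt ((ℓ + 1) ^ k) Ωc (fineDom ((ℓ + 1) ^ k) Ωc) y x ≠ 0)
    (hx : ∀ μ, |rpos ((ℓ + 1) ^ k) Ωc x μ - ((((ℓ + 1) ^ k : ℕ) : ℝ) * K) * j μ|
      ≤ 3 / 4 * ((((ℓ + 1) ^ k : ℕ) : ℝ) * K)) :
    cubeT F κ ℓ k Ωc K At j y x
      = contourTrans (fieldLink F κ A) (rbaseEmb (one_le_n ℓ k) Ωc) (rstairContour (one_le_n ℓ k) Ωc) y x := by
  show (if cubeS ℓ k Ωc K j x then _ else _) = _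
  rw [if_pos (cubeS_of_core ℓ k Ωc hK j x hx)]
  unfold contourTrans
  refine B4Lower18RegularRegion.transport_congr (fun u v huv => ?_) _ _
    (rstairContour_core Ωc (one_le_n ℓ k) hK4 j y x (rBlkWt_ne_zero hyx) hx)
  unfold fieldLink
  rw [hAt u v huv.1 huv.2.1 huv.2.2]

/-! ## §5. The sub-region `Ω ∩ □̂_j` is a union of `K`-blocks when `Ω` is -/

omit [Fintype ι] [DecidableEq ι] in
/-- **`Ω ∩ □̂_j` IS A FINITE UNION OF `K`-BLOCKS** when `Ω` is («Ω a sum of big blocks», p.573): the hypothesis of the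
boundary-cube `‖·‖_{2,2}` factor `B4Eq221HjRegion.eq221_l2_region_hZ`. [cite: Balaban1983RegularityDecay, p.573 «Ω … a
sum of big blocks», §2 p.575 «□_j = Ω ∩ {…}»] -/
theorem isBlockUnion_subLabels {K : ℕ} (hK : 1 ≤ K) (hΩ : IsBlockUnion K Ωc) (j : Fin (d + 1) → ℤ) :
    IsBlockUnion K (subLabels Ωc K j) := by
  intro x hx z hz
  rw [Finset.mem_inter] at hx ⊢
  refine ⟨hΩ hx.1 hz, ?_⟩
  have hx2 := mem_cubeLabels.1 hx.2
  rw [mem_cubeLabels]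
  intro i
  have hK0 : (0 : ℤ) < K := by exact_mod_cast hK
  have hb : z i / (K : ℤ) = x i / (K : ℤ) := congr_fun hz i
  obtain ⟨h1, h2⟩ := hx2 i
  constructor
  · have h3 : j i - 1 ≤ x i / (K : ℤ) := (Int.le_ediv_iff_mul_le hK0).2 (by linarith)
    rw [← hb] at h3
    have h4 := (Int.le_ediv_iff_mul_le hK0).1 h3
    linarith
  · have h3 : x i / (K : ℤ) < j i + 1 := (Int.ediv_lt_iff_lt_mul hK0).2 (by linarith)
    rw [← hb] at h3
    have h4 := (Int.ediv_lt_iff_lt_mul hK0).1 h3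
    linarith

end Cube

end

end Literature.MathematicalPhysics.QuantumFieldTheory.Balaban1983to89.B4CubeGreenRegion
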